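import Literature.AlgebraicGeometry.ShimuraVarieties.UnitaryShimuraComplexGaloisTwist
import Literature.AlgebraicGeometry.ShimuraVarieties.UnitaryShimuraReciprocityOfGaloisTwist
import HarnessLib

/-!
# Reciprocity of a form from the twist property of its transported Galois automorphisms ([Deligne 1979] 2.2.5 ⇔ twist datum)

Topic `AlgebraicGeometry/ShimuraVarieties`; namespace `Literature.AlgebraicGeometry.ShimuraVarieties.UnitaryCanonicalModel.ComplexRecordSystem`
(sequel of `UnitaryShimuraComplexGaloisTwist` and of `UnitaryShimuraReciprocityOfGaloisTwist`).  THEOREMS ONLY; net Literature debt 0.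
Cell `hodgecm-mathlib` (D-0151), row I-6 `descentToIntersection_printed`, last step of the descent: once the descended `E`-model
`(M₀, e₀)` has `e₀`-conjugated Galois automorphisms that are TWISTS (`IsTwist`, from the descent datum), Shimura reciprocity (62)
over `E` for `(M₀, e₀)` — `IsCanonicalDescentOver` — is READ OFF (the tree's `isCanonicalDescentOver_of_gal_twist`); conversely a
form with reciprocity has twist conjugates (`IsTwist.gal_transport`), so the two are EQUIVALENT (`isCanonicalDescentOver_iff_isTwist`).

HC_CM is proved only modulo the 7 printed citations until rung 0 closes; this file discharges none of them by itself.

## References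
* [Deligne1979ShimuraVarieties] P. Deligne, *Variétés de Shimura* (1979), 2.2.4–2.2.5 (PDF p. 29 of Milne's translation).
* [Deligne1971TravauxShimura] P. Deligne, *Travaux de Shimura* (1971), Prop. 5.10 (p. 157).
* [Milne2005ShimuraVarieties] J. S. Milne, *Introduction to Shimura varieties* (2005/2017), Def. 12.8 (62) p. 114.
-/

set_option autoImplicit false

noncomputable section

open Function MulAction Topology NumberField IsDedekindDomain CategoryTheory CategoryTheory.Limits Matrix
  AlgebraicGeometry Cardinal
open scoped Matrix ComplexOrder
open Literature.AlgebraicGeometry.Motives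
open Literature.NumberTheory.Automorphic Literature.NumberTheory.Automorphic.UnitaryGroup
open Literature.NumberTheory.Automorphic.Liu2021.AppendixC (C5.OpenCompactSubgroup C5.SmallLevel)
open Literature.Geometry.ComplexHyperbolic Literature.Geometry.ComplexHyperbolic.BallModel
open Literature.NumberTheory.Automorphic.ShimuraDissection

namespace Literature.AlgebraicGeometry.ShimuraVarieties.UnitaryCanonicalModel

variable {L : Type} [Field L] [NumberField L] [IsCMField L] {H : Matrix (Fin 3) (Fin 3) L}
  {τ : L →+* ℂ} {T : GL (Fin 3) ℂ} {hT : formCongr (starRingEnd ℂ) T (H.map τ) = BallModel.J}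
  {K₀ : C5.OpenCompactSubgroup ↥(finAdelic (↥(maximalRealSubfield L)) L (IsCMField.complexConj L) 3 H)}

namespace ComplexRecordSystem

/-- **Reciprocity (62) over `E` from the twist property** ([Deligne1979ShimuraVarieties] 2.2.5 read backwards): if for every level
`K` and every `σ ∈ Aut_E(ℂ)` the `e₀`-conjugate `(e₀.app K).inv.left ≫ gal σ ≫ (e₀.app K).hom.left` of the Galois automorphism of
`M₀_K ⊗_E ℂ` is a twist (`IsTwist`), then the `E`-form `(M₀, e₀)` of the complex tower satisfies Shimura reciprocity at the diagonal
special pairs over `E` (`IsCanonicalDescentOver`) — the (pt) clause of `IsTwist` is exactly the hypothesis of the tree's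
`isCanonicalDescentOver_of_gal_twist`. [cite: Deligne1979ShimuraVarieties, 2.2.4–2.2.5] [cite: Milne2005ShimuraVarieties, Def. 12.8 (62) p. 114] -/
theorem isCanonicalDescentOver_of_isTwist (Sc : ComplexRecordSystem L H τ T hT K₀) (E : IntermediateField ℚ ℂ)
    (M₀ : C5.SmallLevel K₀ ⥤ SchemeOver ↥E) (e₀ : (M₀ ⋙ Motives.baseChange ↥E ℂ) ≅ Sc.Mc)
    (h : ∀ (K : C5.SmallLevel K₀) (σ : ℂ ≃ₐ[↥E] ℂ),
      IsTwist Sc K (σ : ℂ ≃+* ℂ) ((e₀.app K).inv.left ≫ GaloisDescent.gal ℂ (M₀.obj K) σ ≫ (e₀.app K).hom.left)) :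
    IsCanonicalDescentOver Sc (algebraMap ↥E ℂ) M₀ e₀ :=
  isCanonicalDescentOver_of_gal_twist Sc E M₀ e₀ fun K σ s hs v₃ x₀ hx₀ d hd a =>
    (h K σ).2.2.2 s hs v₃ x₀ hx₀ d hd a

/-- **Reciprocity over `E` ⇔ twist conjugates** (for `E ∋ τ(L)`): an `E`-form of the complex tower satisfies (62) over `E` iff all
`e`-conjugated Galois automorphisms of its complexified levels are twists (`IsTwist.gal_transport` ∕ `isCanonicalDescentOver_of_isTwist`).
[cite: Deligne1979ShimuraVarieties, 2.2.4–2.2.5] [cite: Deligne1971TravauxShimura, Prop. 5.10 (p. 157)] -/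
theorem isCanonicalDescentOver_iff_isTwist (Sc : ComplexRecordSystem L H τ T hT K₀) (E : IntermediateField ℚ ℂ)
    (hτE : ∀ x : L, τ x ∈ E) (M₀ : C5.SmallLevel K₀ ⥤ SchemeOver ↥E) (e₀ : (M₀ ⋙ Motives.baseChange ↥E ℂ) ≅ Sc.Mc) :
    IsCanonicalDescentOver Sc (algebraMap ↥E ℂ) M₀ e₀ ↔
      ∀ (K : C5.SmallLevel K₀) (σ : ℂ ≃ₐ[↥E] ℂ),
        IsTwist Sc K (σ : ℂ ≃+* ℂ) ((e₀.app K).inv.left ≫ GaloisDescent.gal ℂ (M₀.obj K) σ ≫ (e₀.app K).hom.left) :=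
  ⟨fun hM K σ => IsTwist.gal_transport Sc E hτE M₀ e₀ hM K σ, isCanonicalDescentOver_of_isTwist Sc E M₀ e₀⟩

end ComplexRecordSystem

end Literature.AlgebraicGeometry.ShimuraVarieties.UnitaryCanonicalModel

end
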